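import Summits.QuantumFields.YangMills.Theorems.BalabanUVNodesN19BillFlag

/-!
# BalabanUVNodes ∕ node N19 (NE7) — THE EXCHANGE RATE IS REAL: a two-point datum with a SUMMABLE MEAN bill on which the ZERO-SHELL binder list `HybridNE7 … Bad W 0 0 0 δ` FAILS
# FOR EVERY FLAG `Bad`, EVERY `W`, EVERY `δ` (keep both classes ⇒ the `Core` radius pays `a_K`; flag either ⇒ N20 pays `p_K`; `Σ min(a_K, p_K) = ∞`), while the SHELL slot (N21)
# pays the same datum LINEARLY in the mean bill; the EXACT zero-shell criterion there is `Σ_K min(a_K, ρ_K) < ∞` («flags pay min(bill, mass)») — the square root of p623522's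
# Markov dial is not an artefact of threshold flags, and the shell dial is the instrument for diffuse bills

Cell `pub-ymgap` (HUMAN RULING D-0062 Track A ∕ D-0149 width seats), WIDTH SEAT `pub-ymgap-dag-n19-w1` (node n19 = NE7, seat 1 of 3), generation g5, CLAIM-5 ∕ INTENT-5.  Route
`Summits/QuantumFields/YangMills/Theses/BalabanUVNodes.lean`, key item K3⁸ `SpineGivenEndpointR13SepCoPHV` (stmt-QuantumFields-27366, KEY MAP v2; the (δⱽ) display of K3⁷
stmt-QuantumFields-20544; stub 2 `stub_expansion13HV`, conjuncts N19′ `KeyedCoreEdgeHolderD4V` ∧ N20 `KeyedRelWeight` ∧ N21 `KeyedShellWeight`); filed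
`--kind proof --supports … --as helper`.  COUNT-NEUTRAL.  THEOREMS ONLY (0 `def`, 0 `sorry`).  ADDITIVE — imports this seat's g5 `…Theorems.BalabanUVNodesN19BillFlag` (p623522; through
it the tree's `Spine/NE7/Targets` (`Core`), `T4MatchingAssembly` (`HybridNE7`, `hybridNE7_of_relWeightBound`), `T4WeightBudget` (`RelWeightBound`), `T4IndicatorShell`
(`ShellWeightBound`)) ONLY; modifies nothing.

WHY.  p623522 `exists_markovDial_iff` says a THRESHOLD flag paid by Markov needs `Σ √(μ_K∕vol) < ∞` — a square root against the mean bill `μ_K`.  Is the root the price of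
THRESHOLD flags, or of flags as such?  THIS FILE decides it on the smallest datum: per level a QUIET class (both runs `1`) and a LOUD class (run A `p_K`, run B `p_K e^{a_K}`: weight
`p_K ∈ (0,1]`, two-run bill `a_K ≥ 0`).
* §1 [folklore] `sum_twoPoint` (totals) · `meanBill_twoPoint` (both runs' MEAN-bill letters hold with `μ_K = a_K p_K e^{a_K}`).
* §2 [folklore] ★★★ `not_hybridNE7_zeroShell_twoPoint` — `0 ≤ l₀`, `0 < vol`, `0 < p_K ≤ 1`, `a_K ≥ 0`, `Σ_K min(a_K, p_K) = ∞` ⇒ `¬ ∃ Bad W δ, HybridNE7 l₀ vol univ A B Bad W 0 0 0 δ`: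
  at each level, at the source `t = 0`, either a class is flagged (N20's `RelWeightBound` forces `W_K ≥ p_K∕2`) or both are kept (`Core` forces `a_K ≤ 2·vol·δ_K`), so
  `min(a_K, p_K) ≤ 2·vol·|δ_K| + 2·W_K`, summable — contradiction.  EVERY flag, source-dependent or not.
* §2b [folklore] `min_le_of_hybridNE7_zeroShell_twoPoint` (the level inequality in sharp form, `ρ_K := p_K e^{a_K}∕(1 + p_K e^{a_K})` = run B's loud fraction) ·
  ★★ `exists_hybridNE7_zeroShell_twoPoint_iff` — the EXACT zero-shell criterion on the datum: `(∃ Bad W δ, HybridNE7 … Bad W 0 0 0 δ) ↔ Σ_K min(a_K, ρ_K) < ∞` (⇐: flag the loud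
  class where `ρ_K ≤ a_K`, keep both elsewhere with constant `a_K∕2`, radius `a_K∕(2·vol)`): with flags alone the loud class costs `min(bill, mass)`.
* §3 [folklore] ★★ `hybridNE7_shell_twoPoint` — the SAME datum carries the FULL binder list with shells: `shB(loud) = p_K(e^{a_K} − 1)` (shave run B's loud excess), `shA = 0`, EMPTY
  bad class, `W = 0`, `δ = 0`, `Wsh_K = p_K(e^{a_K} − 1)` — provided `Wsh_K < 1` summable: the shell slot pays the ℓ¹ mismatch, i.e. the MEAN bill, LINEARLY (the two-point
  instance of dag-n20-w4's p609004 `exists_hybridNE7_noBad_of_exists_hybridNE7` ∕ `exists_hybridNE7_iff_target_and_classLawTV` and dag-n20-w3's shell-dial series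
  p615422 ∕ p617153 ∕ p618289 ∕ p620040 — cited, nothing of theirs restated; §2 is the CONVERSE comparison those files do not make: the flag slot alone is STRICTLY weaker).
* §4 [folklore] the regime `a_K = p_K = 1∕(K+2)`: `not_summable_min_regime` (`Σ 1∕(K+2) = ∞`) · ★ `shell_regime` (`p_K(e^{a_K} − 1) < 1`,
  summable; the MEAN bill `a_K p_K e^{a_K} ≤ 3∕(K+2)^2` summable) · ★★ `regime_twoPoint` (assembled: NO zero-shell binder list for any flag ∧ the shell binder list holds).
READINGS (located; nothing proposed).  (i) With flags alone (N20's slot) a diffuse bill is paid at a ROOT of its mean — by ANY flag, not just thresholds; with the shell slot (N21)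
it is paid at its mean, AT FIXED VOLUME: the shell weight `Wsh` is a RELATIVE MASS (extensive in the number of shaved classes ∕ loud blocks) while the `Core` radius `vol·δ` is per
unit volume — on a block-product datum (p617743, `vol := m` blocks) a per-block bill is paid by the radius at an `m`-independent per-unit-volume price (`window_key_core_perUnitVolume`)
where shaving it would cost a shell mass growing with `m`.  So for the N19′ ∧ N20 ∧ N21 triple of stub 2: FLAG the rare classes with a LARGE bill (pending old regions, many loud
blocks); SHAVE `O(1)`-mass misfits into the shell; pay extensive-but-homogeneous bills by the `Core` radius per unit volume — and a v6∕v7 text that PINS the shell split `sh` to an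
indicator-shell of record (START-LIST §n20 «natural v6 pins … `sh := shellSplitOfRecord₁₃At`») forecloses the shell instrument for LR misfits unless that split absorbs them;
under the free `∃ sh` of v5∕«v6» it is available.  (ii) Nothing here is Bałaban's; which bills the d = 4 densities produce is unprinted and unproved.

HONEST FRAMING.  One explicit two-point datum (free sequences `p, a`, one numerical regime) + [folklore] finite-sum ∕ real-series arithmetic over the tree's SHAPES (`Core`,
`RelWeightBound`, `ShellWeightBound`, `HybridNE7`); nothing of Bałaban's is asserted or instantiated; no estimate of the programme is proved.  NE7 ∕ NE7b ∕ NE7c NOT PRINTED as two-run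
statements for d = 4 ∕ NOT proved; N19 ∕ N20 ∕ N21 NOT discharged; K3⁸ OPEN, not claimed, «v6» untouched; counts UNMOVED (typed 28∕28 · discharged 5∕27, A 5∕28).  Everything below is
PROVED (0 `sorry`, 0 named facts, standard axioms); no decl carries a cite tag.  One finite four-torus programme at fixed ε — NOT ℝ⁴, NOT infinite volume, NOT OS, NOT a mass gap, NOT
the Clay problem (R4 closes the conditional finite-𝕋⁴ rung `BalabanLadder.UV` only).
-/

noncomputable section

open Finset
open scoped BigOperators

namespace Summit.QuantumFields.YangMills.BalabanUVNodes.N19BillFlagExchangeRate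

open Summit.QuantumFields.BalabanUV.T4Continuum.Spine.NE7 (Core)
open Literature.MathematicalPhysics.QuantumFieldTheory.Balaban1983to89
open T4WeightBudget (RelWeightBound)
open T4IndicatorShell (ShellWeightBound)
open T4MatchingAssembly (HybridNE7 hybridNE7_of_relWeightBound)

variable {l₀ vol : ℝ} {p a : ℕ → ℝ}

/-! ## §1 The two-point datum: a quiet class of weight `1` and a loud class of weight `p_K` carrying a two-run bill `a_K` [folklore] -/

/-- Run A's total is `p_K + 1`, run B's `p_K e^{a_K} + 1`. [folklore] -/
theorem sum_twoPoint (K : ℕ) :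
    ∑ b ∈ (Finset.univ : Finset Bool), (if b then p K else (1 : ℝ)) = p K + 1 ∧
      ∑ b ∈ (Finset.univ : Finset Bool), (if b then p K * Real.exp (a K) else (1 : ℝ)) = p K * Real.exp (a K) + 1 := by
  constructor <;> simp

/-- **THE MEAN BILL OF THE DATUM** [folklore]: with the bill `u(quiet) = 0`, `u(loud) = a_K` (`a_K ≥ 0`, `p_K > 0`), both runs' mean-bill letters hold with
`μ_K := a_K·p_K·e^{a_K}` (run A's mean bill is `a_K p_K∕(1+p_K) ≤ μ_K`). -/
theorem meanBill_twoPoint (hp0 : ∀ K, 0 < p K) (ha : ∀ K, 0 ≤ a K) (K : ℕ) :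
    ∑ b ∈ (Finset.univ : Finset Bool), (if b then a K else 0) * (if b then p K else (1 : ℝ)) ≤
        (a K * p K * Real.exp (a K)) * ∑ b ∈ (Finset.univ : Finset Bool), (if b then p K else (1 : ℝ)) ∧
      ∑ b ∈ (Finset.univ : Finset Bool), (if b then a K else 0) * (if b then p K * Real.exp (a K) else (1 : ℝ)) ≤
        (a K * p K * Real.exp (a K)) * ∑ b ∈ (Finset.univ : Finset Bool), (if b then p K * Real.exp (a K) else (1 : ℝ)) := by
  have hp := hp0 K; have haK := ha K
  have he : 1 ≤ Real.exp (a K) := Real.one_le_exp haK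
  have hap : 0 ≤ a K * p K := mul_nonneg haK hp.le
  constructor
  · simp only [Fintype.sum_bool, if_true, Bool.false_eq_true, if_false, zero_mul, add_zero]
    nlinarith [mul_nonneg hap (sub_nonneg.mpr he), mul_nonneg (mul_nonneg hap (Real.exp_pos (a K)).le) hp.le]
  · simp only [Fintype.sum_bool, if_true, Bool.false_eq_true, if_false, zero_mul, add_zero]
    have h0 : 0 ≤ a K * p K * Real.exp (a K) := by positivity
    nlinarith [mul_nonneg h0 (mul_nonneg hp.le (Real.exp_pos (a K)).le)]

/-! ## §2 A summable MEAN bill does not buy the zero-shell binder list under ANY flag [folklore] -/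

/-- **★★★ THE EXCHANGE RATE IS REAL** [folklore].  On the two-point datum (`0 < p_K ≤ 1`, `a_K ≥ 0`, `0 ≤ l₀`, `0 < vol`): if `Σ_K min(a_K, p_K) = ∞` then there is NO bad class
`Bad` (any, source-dependent), NO weight `W` and NO radius `δ` with the ZERO-SHELL binder list `HybridNE7 l₀ vol univ A B Bad W 0 0 0 δ`.  At each level one either FLAGS the loud
class (N20 pays `≥ p_K∕2`), flags the quiet one (pays `≥ 1∕2 ≥ p_K∕2`), or keeps both (the `Core` radius pays `≥ a_K∕2`).  With `a_K = p_K = 1∕(K+2)` the MEAN bill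
`a_K p_K e^{a_K} ≤ e∕(K+2)^2` IS summable (§4) — so «summable mean bill» buys nothing by itself: the root in p623522's `exists_markovDial_iff` is not an artefact of threshold flags. -/
theorem not_hybridNE7_zeroShell_twoPoint (hl₀ : 0 ≤ l₀) (hvol : 0 < vol) (hp0 : ∀ K, 0 < p K) (hp1 : ∀ K, p K ≤ 1) (ha : ∀ K, 0 ≤ a K)
    (hdiv : ¬ Summable fun K => min (a K) (p K)) :
    ¬ ∃ (Bad : ℕ → ℝ → Finset Bool) (W δ : ℕ → ℝ),
      HybridNE7 l₀ vol (fun _ => (Finset.univ : Finset Bool)) (fun K _ b => if b then p K else (1 : ℝ))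
        (fun K _ b => if b then p K * Real.exp (a K) else (1 : ℝ)) Bad W (fun _ _ _ => 0) (fun _ _ _ => 0) (fun _ => 0) δ := by
  rintro ⟨Bad, W, δ, h⟩
  apply hdiv
  have hW := h.weight
  have ht0 : |(0 : ℝ)| ≤ l₀ := by simpa using hl₀
  refine Summable.of_nonneg_of_le (fun K => le_min (ha K) (hp0 K).le) (fun K => ?_) ((h.summable.abs.mul_left (2 * vol)).add (hW.summable.mul_left 2))
  have hWK := hW.nonneg K
  have hpK := hp0 K
  have hbl := hW.bad_left K 0 ht0
  rw [(sum_twoPoint (a := a) K).1] at hbl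
  have hterm : ∀ b ∈ Bad K 0, (0 : ℝ) ≤ (if b then p K else 1) := fun b _ => by split_ifs <;> linarith
  by_cases htt : true ∈ Bad K 0
  · -- the loud class is flagged: `p ≤ Σ_Bad A ≤ W·(p+1) ≤ 2W`
    have h1 : p K ≤ ∑ b ∈ Bad K 0, (if b then p K else (1 : ℝ)) := by
      simpa using Finset.single_le_sum hterm htt
    have hp1K := hp1 K
    calc min (a K) (p K) ≤ p K := min_le_right _ _
      _ ≤ 2 * vol * |δ K| + 2 * W K := by nlinarith [abs_nonneg (δ K), hvol.le]
  · by_cases hff : false ∈ Bad K 0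
    · -- the quiet class is flagged: `1 ≤ Σ_Bad A ≤ W·(p+1) ≤ 2W`, and `p ≤ 1`
      have h1 : (1 : ℝ) ≤ ∑ b ∈ Bad K 0, (if b then p K else (1 : ℝ)) := by
        simpa using Finset.single_le_sum hterm hff
      have hp1K := hp1 K
      calc min (a K) (p K) ≤ p K := min_le_right _ _
        _ ≤ 2 * vol * |δ K| + 2 * W K := by nlinarith [abs_nonneg (δ K), hvol.le]
    · -- both classes kept: the `Core` sandwich at `t = 0` forces `a ≤ 2·vol·δ`
      obtain ⟨c, hc⟩ := h.core K
      have hgt : true ∈ (Finset.univ : Finset Bool) \ Bad K 0 := Finset.mem_sdiff.mpr ⟨Finset.mem_univ _, htt⟩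
      have hgf : false ∈ (Finset.univ : Finset Bool) \ Bad K 0 := Finset.mem_sdiff.mpr ⟨Finset.mem_univ _, hff⟩
      obtain ⟨-, h2⟩ := hc 0 ht0 true hgt
      obtain ⟨h3, -⟩ := hc 0 ht0 false hgf
      simp only [if_true, Bool.false_eq_true, if_false, sub_zero, mul_one] at h2 h3
      have e1 : c - vol * δ K ≤ 0 := Real.exp_le_one_iff.mp h3
      have e2 : a K ≤ c + vol * δ K := by
        have h2' : p K * Real.exp (a K) ≤ p K * Real.exp (c + vol * δ K) := by linarith
        exact Real.exp_le_exp.mp (le_of_mul_le_mul_left h2' hpK)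
      calc min (a K) (p K) ≤ a K := min_le_left _ _
        _ ≤ 2 * vol * |δ K| + 2 * W K := by nlinarith [le_abs_self (δ K), hvol.le]

/-! ### §2b The exact zero-shell criterion on the two-point datum: `Σ_K min(a_K, ρ_K) < ∞`, `ρ_K` = run B's loud fraction [folklore] -/

/-- **THE LEVEL INEQUALITY, SHARP FORM** [folklore]: any zero-shell binder list on the two-point datum (`0 < p_K ≤ 1`, any `a_K`) has, at every level,
`min(a_K, ρ_K) ≤ 2·vol·|δ_K| + 2·W_K` with `ρ_K := p_K e^{a_K}∕(1 + p_K e^{a_K})` run B's loud fraction (flag the loud class ⇒ `W_K ≥ ρ_K` by run B's clause; flag the quiet one ⇒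
`W_K ≥ 1∕2`; keep both ⇒ `a_K ≤ 2·vol·δ_K`). -/
theorem min_le_of_hybridNE7_zeroShell_twoPoint {Bad : ℕ → ℝ → Finset Bool} {W δ : ℕ → ℝ} (hl₀ : 0 ≤ l₀) (hvol : 0 < vol)
    (hp0 : ∀ K, 0 < p K) (hp1 : ∀ K, p K ≤ 1)
    (h : HybridNE7 l₀ vol (fun _ => (Finset.univ : Finset Bool)) (fun K _ b => if b then p K else (1 : ℝ))
        (fun K _ b => if b then p K * Real.exp (a K) else (1 : ℝ)) Bad W (fun _ _ _ => 0) (fun _ _ _ => 0) (fun _ => 0) δ) (K : ℕ) :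
    min (a K) (p K * Real.exp (a K) / (1 + p K * Real.exp (a K))) ≤ 2 * vol * |δ K| + 2 * W K := by
  have hW := h.weight
  have ht0 : |(0 : ℝ)| ≤ l₀ := by simpa using hl₀
  have hWK := hW.nonneg K
  have hpK := hp0 K
  have hq : 0 < p K * Real.exp (a K) := mul_pos hpK (Real.exp_pos _)
  have hρ1 : p K * Real.exp (a K) / (1 + p K * Real.exp (a K)) < 1 := by rw [div_lt_one (by linarith)]; linarith
  have hbl := hW.bad_left K 0 ht0
  have hbr := hW.bad_right K 0 ht0
  rw [(sum_twoPoint (a := a) K).1] at hbl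
  rw [(sum_twoPoint (p := p) (a := a) K).2] at hbr
  have htermA : ∀ b ∈ Bad K 0, (0 : ℝ) ≤ (if b then p K else 1) := fun b _ => by split_ifs <;> linarith
  have htermB : ∀ b ∈ Bad K 0, (0 : ℝ) ≤ (if b then p K * Real.exp (a K) else 1) := fun b _ => by split_ifs <;> linarith
  by_cases htt : true ∈ Bad K 0
  · -- loud flagged: run B's clause gives `p e^a ≤ W (p e^a + 1)`, i.e. `ρ ≤ W`
    have h1 : p K * Real.exp (a K) ≤ ∑ b ∈ Bad K 0, (if b then p K * Real.exp (a K) else (1 : ℝ)) := by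
      simpa using Finset.single_le_sum htermB htt
    have hρW : p K * Real.exp (a K) / (1 + p K * Real.exp (a K)) ≤ W K := by
      rw [div_le_iff₀ (by linarith)]; linarith
    calc min (a K) (p K * Real.exp (a K) / (1 + p K * Real.exp (a K))) ≤ p K * Real.exp (a K) / (1 + p K * Real.exp (a K)) := min_le_right _ _
      _ ≤ 2 * vol * |δ K| + 2 * W K := by nlinarith [abs_nonneg (δ K), hvol.le]
  · by_cases hff : false ∈ Bad K 0
    · -- quiet flagged: `1 ≤ W (p + 1) ≤ 2 W`
      have h1 : (1 : ℝ) ≤ ∑ b ∈ Bad K 0, (if b then p K else (1 : ℝ)) := by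
        simpa using Finset.single_le_sum htermA hff
      have hp1K := hp1 K
      calc min (a K) (p K * Real.exp (a K) / (1 + p K * Real.exp (a K))) ≤ p K * Real.exp (a K) / (1 + p K * Real.exp (a K)) := min_le_right _ _
        _ ≤ 1 := hρ1.le
        _ ≤ 2 * vol * |δ K| + 2 * W K := by nlinarith [abs_nonneg (δ K), hvol.le]
    · obtain ⟨c, hc⟩ := h.core K
      have hgt : true ∈ (Finset.univ : Finset Bool) \ Bad K 0 := Finset.mem_sdiff.mpr ⟨Finset.mem_univ _, htt⟩
      have hgf : false ∈ (Finset.univ : Finset Bool) \ Bad K 0 := Finset.mem_sdiff.mpr ⟨Finset.mem_univ _, hff⟩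
      obtain ⟨-, h2⟩ := hc 0 ht0 true hgt
      obtain ⟨h3, -⟩ := hc 0 ht0 false hgf
      simp only [if_true, Bool.false_eq_true, if_false, sub_zero, mul_one] at h2 h3
      have e1 : c - vol * δ K ≤ 0 := Real.exp_le_one_iff.mp h3
      have e2 : a K ≤ c + vol * δ K := by
        have h2' : p K * Real.exp (a K) ≤ p K * Real.exp (c + vol * δ K) := by linarith
        exact Real.exp_le_exp.mp (le_of_mul_le_mul_left h2' hpK)
      calc min (a K) (p K * Real.exp (a K) / (1 + p K * Real.exp (a K))) ≤ a K := min_le_left _ _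
        _ ≤ 2 * vol * |δ K| + 2 * W K := by nlinarith [le_abs_self (δ K), hvol.le]

/-- **★★ THE ZERO-SHELL BINDER LIST EXISTS ON THE TWO-POINT DATUM IFF `Σ_K min(a_K, ρ_K) < ∞`** [folklore] (`0 < p_K ≤ 1`, `a_K ≥ 0`, `0 ≤ l₀`, `0 < vol`; `ρ_K` run B's loud
fraction).  ⇒: the level inequality.  ⇐: per level FLAG the loud class when `ρ_K ≤ a_K` (N20 pays `ρ_K`), else KEEP both (constant `a_K∕2`, radius `a_K∕(2·vol)`).  So with flags
alone the price of the loud class is `min(bill, mass)`; with shells (§3) it is `mass × (e^{bill} − 1)` — smaller whenever `bill < log 2`, and of a different ORDER for diffuse bills. -/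
theorem exists_hybridNE7_zeroShell_twoPoint_iff (hl₀ : 0 ≤ l₀) (hvol : 0 < vol) (hp0 : ∀ K, 0 < p K) (hp1 : ∀ K, p K ≤ 1) (ha : ∀ K, 0 ≤ a K) :
    (∃ (Bad : ℕ → ℝ → Finset Bool) (W δ : ℕ → ℝ),
        HybridNE7 l₀ vol (fun _ => (Finset.univ : Finset Bool)) (fun K _ b => if b then p K else (1 : ℝ))
          (fun K _ b => if b then p K * Real.exp (a K) else (1 : ℝ)) Bad W (fun _ _ _ => 0) (fun _ _ _ => 0) (fun _ => 0) δ) ↔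
      Summable fun K => min (a K) (p K * Real.exp (a K) / (1 + p K * Real.exp (a K))) := by
  have hq : ∀ K, 0 < p K * Real.exp (a K) := fun K => mul_pos (hp0 K) (Real.exp_pos _)
  have hρ0 : ∀ K, 0 < p K * Real.exp (a K) / (1 + p K * Real.exp (a K)) := fun K => div_pos (hq K) (by linarith [hq K])
  have hρ1 : ∀ K, p K * Real.exp (a K) / (1 + p K * Real.exp (a K)) < 1 := fun K => by rw [div_lt_one (by linarith [hq K])]; linarith [hq K]
  have hmin0 : ∀ K, 0 ≤ min (a K) (p K * Real.exp (a K) / (1 + p K * Real.exp (a K))) := fun K => le_min (ha K) (hρ0 K).le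
  constructor
  · rintro ⟨Bad, W, δ, h⟩
    exact Summable.of_nonneg_of_le hmin0 (min_le_of_hybridNE7_zeroShell_twoPoint hl₀ hvol hp0 hp1 h)
      ((h.summable.abs.mul_left (2 * vol)).add (h.weight.summable.mul_left 2))
  · intro hs
    classical
    -- the flag: loud iff `ρ_K ≤ a_K`; weight `ρ_K` there; radius `a_K∕(2 vol)` where both are kept
    refine ⟨fun K _ => if p K * Real.exp (a K) / (1 + p K * Real.exp (a K)) ≤ a K then {true} else ∅,
      fun K => if p K * Real.exp (a K) / (1 + p K * Real.exp (a K)) ≤ a K then p K * Real.exp (a K) / (1 + p K * Real.exp (a K)) else 0,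
      fun K => if p K * Real.exp (a K) / (1 + p K * Real.exp (a K)) ≤ a K then 0 else a K / (2 * vol), ?_⟩
    have hA0 : ∀ (K : ℕ) (t : ℝ), |t| ≤ l₀ → ∀ b ∈ (Finset.univ : Finset Bool), 0 ≤ (if b then p K else (1 : ℝ)) :=
      fun K _ _ b _ => by have := hp0 K; split_ifs <;> positivity
    have hB0 : ∀ (K : ℕ) (t : ℝ), |t| ≤ l₀ → ∀ b ∈ (Finset.univ : Finset Bool), 0 ≤ (if b then p K * Real.exp (a K) else (1 : ℝ)) :=
      fun K _ _ b _ => by have := hq K; split_ifs <;> positivity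
    have hW : RelWeightBound l₀ (fun _ => (Finset.univ : Finset Bool)) (fun K _ b => if b then p K else (1 : ℝ))
        (fun K _ b => if b then p K * Real.exp (a K) else (1 : ℝ))
        (fun K _ => if p K * Real.exp (a K) / (1 + p K * Real.exp (a K)) ≤ a K then {true} else ∅)
        (fun K => if p K * Real.exp (a K) / (1 + p K * Real.exp (a K)) ≤ a K then p K * Real.exp (a K) / (1 + p K * Real.exp (a K)) else 0) :=
      { bad_subset := fun _ _ _ => Finset.subset_univ _
        nonneg := fun K => by split_ifs <;> [exact (hρ0 K).le; exact le_rfl]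
        lt_one := fun K => by split_ifs <;> [exact hρ1 K; exact zero_lt_one]
        summable := Summable.of_nonneg_of_le (fun K => by split_ifs <;> [exact (hρ0 K).le; exact le_rfl])
          (fun K => by
            split_ifs with h
            · exact le_min h le_rfl
            · exact hmin0 K) hs
        bad_left := fun K t _ => by
          split_ifs with h
          · rw [Finset.sum_singleton, (sum_twoPoint (a := a) K).1, if_pos rfl, div_mul_eq_mul_div, le_div_iff₀ (by linarith [hq K])]
            have := hp0 K; have := Real.one_le_exp (ha K)
            nlinarith [mul_le_mul_of_nonneg_left (Real.one_le_exp (ha K)) (hp0 K).le]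
          · simp
        bad_right := fun K t _ => by
          split_ifs with h
          · rw [Finset.sum_singleton, (sum_twoPoint (p := p) (a := a) K).2, if_pos rfl, div_mul_eq_mul_div, le_div_iff₀ (by linarith [hq K])]
            nlinarith [hq K]
          · simp }
    refine T4MatchingAssembly.hybridNE7_noShell hW hA0 hB0 ?_ fun K => ?_
    · refine Summable.of_nonneg_of_le (fun K => by split_ifs <;> [exact le_rfl; exact div_nonneg (ha K) (by positivity)]) (fun K => ?_)
        (hs.div_const (2 * vol))
      split_ifs with h
      · exact div_nonneg (hmin0 K) (by positivity)
      · rw [min_eq_left (le_of_lt (not_le.mp h))]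
    · by_cases h : p K * Real.exp (a K) / (1 + p K * Real.exp (a K)) ≤ a K
      · -- loud flagged, quiet kept: constant `0`, radius `0`
        refine ⟨0, fun t _ b hb => ?_⟩
        simp only [h, if_true, Finset.mem_sdiff, Finset.mem_univ, Finset.mem_singleton, true_and] at hb
        have hb' : b = false := by simpa using hb
        subst hb'
        simp [h]
      · -- both kept: constant `a∕2`, radius `a∕(2 vol)`
        refine ⟨a K / 2, fun t _ b _ => ?_⟩
        have hv : vol * (a K / (2 * vol)) = a K / 2 := by field_simp
        simp only [h, if_false, hv, sub_self, Real.exp_zero, one_mul]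
        cases b
        · simp only [Bool.false_eq_true, if_false, mul_one]
          exact ⟨le_rfl, Real.one_le_exp (by linarith [ha K])⟩
        · simp only [if_true]
          have hx : a K / 2 + a K / 2 = a K := by ring
          rw [hx]
          exact ⟨le_mul_of_one_le_right (hp0 K).le (Real.one_le_exp (ha K)), le_of_eq (by ring)⟩

/-! ## §3 … while the SHELL slot pays the same datum LINEARLY in the mean bill [folklore] -/

/-- **★★ THE SHELL SLOT PAYS THE TWO-POINT DATUM** [folklore].  Shave run B's loud excess into the shell: `shB(loud) = p_K(e^{a_K} − 1)`, `shA = 0`, EMPTY bad class, `W = 0`,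
`δ = 0`; the shell's relative weight is `Wsh_K = p_K(e^{a_K} − 1) ≈` the MEAN bill.  If `p_K(e^{a_K} − 1) < 1` summable: `HybridNE7 l₀ vol univ A B ∅ 0 0 shB Wsh 0` — the full
binder list with shells (N21's slot), where §2 says the zero-shell list fails for every flag.  (The located content of dag-n20-w3's shell-dial series p615422∕p617153∕p618289, here on
the smallest datum: the shell dial prices the ℓ¹ mismatch = the mean bill, linearly; the bad-class flag prices it only after a root.) -/
theorem hybridNE7_shell_twoPoint (hp0 : ∀ K, 0 < p K) (ha : ∀ K, 0 ≤ a K)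
    (hlt : ∀ K, p K * (Real.exp (a K) - 1) < 1) (hsum : Summable fun K => p K * (Real.exp (a K) - 1)) :
    HybridNE7 l₀ vol (fun _ => (Finset.univ : Finset Bool)) (fun K _ b => if b then p K else (1 : ℝ))
      (fun K _ b => if b then p K * Real.exp (a K) else (1 : ℝ)) (fun _ _ => (∅ : Finset Bool)) (fun _ => 0) (fun _ _ _ => 0)
      (fun K _ b => if b then p K * (Real.exp (a K) - 1) else 0) (fun K => p K * (Real.exp (a K) - 1)) (fun _ => 0) := by
  have hsh0 : ∀ K, 0 ≤ p K * (Real.exp (a K) - 1) := fun K => mul_nonneg (hp0 K).le (sub_nonneg.mpr (Real.one_le_exp (ha K)))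
  have hA0 : ∀ (K : ℕ) (b : Bool), 0 ≤ (if b then p K else (1 : ℝ)) := fun K b => by have := hp0 K; split_ifs <;> positivity
  have hB0 : ∀ (K : ℕ) (b : Bool), 0 ≤ (if b then p K * Real.exp (a K) else (1 : ℝ)) := fun K b => by have := hp0 K; split_ifs <;> positivity
  have hW : RelWeightBound l₀ (fun _ => (Finset.univ : Finset Bool)) (fun K _ b => if b then p K else (1 : ℝ))
      (fun K _ b => if b then p K * Real.exp (a K) else (1 : ℝ)) (fun _ _ => (∅ : Finset Bool)) (fun _ => 0) :=
    { bad_subset := fun _ _ _ => Finset.empty_subset _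
      nonneg := fun _ => le_rfl
      lt_one := fun _ => zero_lt_one
      summable := summable_zero
      bad_left := fun K t _ => by rw [Finset.sum_empty, zero_mul]
      bad_right := fun K t _ => by rw [Finset.sum_empty, zero_mul] }
  have hSh : ShellWeightBound l₀ (fun _ => (Finset.univ : Finset Bool)) (fun K _ b => if b then p K else (1 : ℝ))
      (fun K _ b => if b then p K * Real.exp (a K) else (1 : ℝ)) (fun _ _ _ => 0) (fun K _ b => if b then p K * (Real.exp (a K) - 1) else 0)
      (fun K => p K * (Real.exp (a K) - 1)) :=
    { nonneg := hsh0
      summable := hsum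
      sh_nonneg_left := fun _ _ _ _ _ => le_rfl
      sh_le_left := fun K _ _ b _ => hA0 K b
      sh_nonneg_right := fun K _ _ b _ => by have := hsh0 K; split_ifs <;> positivity
      sh_le_right := fun K _ _ b _ => by
        have := hp0 K
        split_ifs
        · nlinarith
        · exact zero_le_one
      left := fun K t _ => by
        rw [Finset.sum_const_zero]
        exact mul_nonneg (hsh0 K) (Finset.sum_nonneg fun b _ => hA0 K b)
      right := fun K t _ => by
        rw [(sum_twoPoint (p := p) (a := a) K).2]
        simp only [Fintype.sum_bool, if_true, Bool.false_eq_true, if_false, add_zero]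
        have := hsh0 K; have := hp0 K
        nlinarith [mul_nonneg (hsh0 K) (mul_nonneg (hp0 K).le (Real.exp_pos (a K)).le)] }
  refine hybridNE7_of_relWeightBound hW hSh (fun K => by simpa using hlt K) summable_zero fun K => ⟨0, fun t _ b _ => ?_⟩
  cases b
  · simp
  · simp only [if_true, sub_zero, add_zero, mul_zero, Real.exp_zero, one_mul]
    constructor <;> linarith

/-! ## §4 The regime `a_K = p_K = 1∕(K+2)`: summable MEAN bill, divergent `Σ min(a, p)`, summable shell weight [folklore] -/

/-- In the regime: `Σ_K min(a_K, p_K) = Σ 1∕(K+2) = ∞` (so §2 applies). [folklore] -/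
theorem not_summable_min_regime : ¬ Summable fun K : ℕ => min (1 / ((K : ℝ) + 2)) (1 / ((K : ℝ) + 2)) := by
  simp only [min_self]
  have h := mt (summable_nat_add_iff (f := fun n : ℕ => 1 / (n : ℝ)) 2).mp Real.not_summable_one_div_natCast
  simpa [Nat.cast_add] using h

/-- In the regime: the shell weight ∕ mean bill `p_K(e^{a_K} − 1) ≤ a_K p_K e^{a_K} ≤ e∕(K+2)^2 < 1`, summable (so §3 applies, and the MEAN bill of §1 is summable). [folklore] -/
theorem shell_regime :
    (∀ K : ℕ, 1 / ((K : ℝ) + 2) * (Real.exp (1 / ((K : ℝ) + 2)) - 1) < 1) ∧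
      (Summable fun K : ℕ => 1 / ((K : ℝ) + 2) * (Real.exp (1 / ((K : ℝ) + 2)) - 1)) ∧
      Summable fun K : ℕ => 1 / ((K : ℝ) + 2) * (1 / ((K : ℝ) + 2)) * Real.exp (1 / ((K : ℝ) + 2)) := by
  have hK : ∀ K : ℕ, (0 : ℝ) < (K : ℝ) + 2 := fun K => by positivity
  have hx1 : ∀ K : ℕ, 1 / ((K : ℝ) + 2) ≤ 1 / 2 := fun K =>
    div_le_div_of_nonneg_left zero_le_one (by norm_num) (by linarith [show (0 : ℝ) ≤ K from Nat.cast_nonneg K])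
  have he : ∀ K : ℕ, Real.exp (1 / ((K : ℝ) + 2)) ≤ 3 := fun K => by
    have h9 := Real.exp_one_lt_d9
    exact (Real.exp_le_exp.mpr ((hx1 K).trans (by norm_num))).trans (h9.le.trans (by norm_num))
  -- the mean bill `x·x·e^x ≤ 3·(1∕(K+2))^2` is summable
  have hmean : Summable fun K : ℕ => 1 / ((K : ℝ) + 2) * (1 / ((K : ℝ) + 2)) * Real.exp (1 / ((K : ℝ) + 2)) := by
    have h2 : Summable fun K : ℕ => 1 / ((K : ℝ)) ^ 2 := Real.summable_one_div_nat_pow.mpr one_lt_two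
    have h2' : Summable fun K : ℕ => 3 * (1 / ((K : ℝ) + 2) ^ 2) := by
      have := (summable_nat_add_iff 2).mpr h2
      simpa [Nat.cast_add] using this.mul_left 3
    refine Summable.of_nonneg_of_le (fun K => by positivity) (fun K => ?_) h2'
    have hx0 : 0 ≤ 1 / ((K : ℝ) + 2) := by positivity
    calc 1 / ((K : ℝ) + 2) * (1 / ((K : ℝ) + 2)) * Real.exp (1 / ((K : ℝ) + 2)) ≤ 1 / ((K : ℝ) + 2) * (1 / ((K : ℝ) + 2)) * 3 :=
          mul_le_mul_of_nonneg_left (he K) (by positivity)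
      _ = 3 * (1 / ((K : ℝ) + 2) ^ 2) := by rw [div_mul_div_comm, one_mul, ← pow_two, mul_comm]
  -- `e^x − 1 ≤ x·e^x` (the tree's `Literature.MathematicalPhysics.QuantumFieldTheory.AreaLaw.exp_sub_one_le_mul_exp`, inlined to keep this file's imports inside the lane)
  have hexp1 : ∀ x : ℝ, Real.exp x - 1 ≤ x * Real.exp x := fun x => by
    have h := Real.add_one_le_exp (-x)
    have hprod : Real.exp (-x) * Real.exp x = 1 := by rw [← Real.exp_add, neg_add_cancel, Real.exp_zero]
    nlinarith [mul_le_mul_of_nonneg_right h (Real.exp_pos x).le]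
  have hle : ∀ K : ℕ, 1 / ((K : ℝ) + 2) * (Real.exp (1 / ((K : ℝ) + 2)) - 1) ≤ 1 / ((K : ℝ) + 2) * (1 / ((K : ℝ) + 2)) * Real.exp (1 / ((K : ℝ) + 2)) :=
    fun K => by
      rw [mul_assoc]
      exact mul_le_mul_of_nonneg_left (hexp1 _) (by positivity)
  have h0 : ∀ K : ℕ, 0 ≤ 1 / ((K : ℝ) + 2) * (Real.exp (1 / ((K : ℝ) + 2)) - 1) := fun K =>
    mul_nonneg (by positivity) (sub_nonneg.mpr (Real.one_le_exp (by positivity)))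
  refine ⟨fun K => ?_, Summable.of_nonneg_of_le h0 hle hmean, hmean⟩
  calc 1 / ((K : ℝ) + 2) * (Real.exp (1 / ((K : ℝ) + 2)) - 1) ≤ 1 / ((K : ℝ) + 2) * (1 / ((K : ℝ) + 2)) * Real.exp (1 / ((K : ℝ) + 2)) := hle K
    _ ≤ 1 / 2 * (1 / 2) * 3 := by
        have hx0 : 0 ≤ 1 / ((K : ℝ) + 2) := by positivity
        have := hx1 K; have := he K
        gcongr
    _ < 1 := by norm_num

/-- **★ THE REGIME, ASSEMBLED** [folklore]: at `a_K = p_K = 1∕(K+2)` (any `0 ≤ l₀`, `0 < vol`) the zero-shell binder list FAILS for every flag (§2) although the mean bill is summable,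
and the shell slot gives the full binder list (§3). -/
theorem regime_twoPoint (hl₀ : 0 ≤ l₀) (hvol : 0 < vol) :
    (¬ ∃ (Bad : ℕ → ℝ → Finset Bool) (W δ : ℕ → ℝ),
        HybridNE7 l₀ vol (fun _ => (Finset.univ : Finset Bool)) (fun K _ b => if b then 1 / ((K : ℝ) + 2) else (1 : ℝ))
          (fun K _ b => if b then 1 / ((K : ℝ) + 2) * Real.exp (1 / ((K : ℝ) + 2)) else (1 : ℝ)) Bad W (fun _ _ _ => 0) (fun _ _ _ => 0) (fun _ => 0) δ) ∧
      HybridNE7 l₀ vol (fun _ => (Finset.univ : Finset Bool)) (fun K _ b => if b then 1 / ((K : ℝ) + 2) else (1 : ℝ))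
        (fun K _ b => if b then 1 / ((K : ℝ) + 2) * Real.exp (1 / ((K : ℝ) + 2)) else (1 : ℝ)) (fun _ _ => (∅ : Finset Bool)) (fun _ => 0) (fun _ _ _ => 0)
        (fun K _ b => if b then 1 / ((K : ℝ) + 2) * (Real.exp (1 / ((K : ℝ) + 2)) - 1) else 0) (fun K => 1 / ((K : ℝ) + 2) * (Real.exp (1 / ((K : ℝ) + 2)) - 1))
        (fun _ => 0) := by
  have hp0 : ∀ K : ℕ, (0 : ℝ) < 1 / ((K : ℝ) + 2) := fun K => by positivity
  have hp1 : ∀ K : ℕ, 1 / ((K : ℝ) + 2) ≤ 1 := fun K => by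
    rw [div_le_one (by positivity)]; linarith [show (0 : ℝ) ≤ K from Nat.cast_nonneg K]
  obtain ⟨hlt, hsum, -⟩ := shell_regime
  exact ⟨not_hybridNE7_zeroShell_twoPoint hl₀ hvol hp0 hp1 (fun K => (hp0 K).le) not_summable_min_regime,
    hybridNE7_shell_twoPoint hp0 (fun K => (hp0 K).le) hlt hsum⟩

end Summit.QuantumFields.YangMills.BalabanUVNodes.N19BillFlagExchangeRate
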